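import Summits.KontsevichZagierPeriods.KontsevichZagierPeriods.Theses.UnfoldedStokes
import Literature.NumberTheory.Transcendental.KZLogCalculusProofs
import Literature.NumberTheory.Transcendental.KZSubcalculusInvariants
import Literature.NumberTheory.Transcendental.KZKernelConjectureForms

/-!
# `HyperellipticRiemannRelation` (stmt-KontsevichZagierPeriods-3522) — negative knowledge, part 1: values, sign patterns, forced moves

Support file for the crux `UnfoldedStokes.HyperellipticRiemannRelation` (cdisprove seat, cycle 1;
work file `Cruxes/HyperellipticRiemannRelation/Disproof.lean`). The crux: for every strictly
increasing `e : Fin 5 → ℚ` and all representations `r₁₂ r₁₄ r₃₄ : KZ.IntegralRep 2` on the boxes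
`J₁×J₂, J₁×J₄, J₃×J₄` (`J_j = (e (j−1), e j)`, the bounded gaps of the quintic
`P(t) = ∏ (t − e i)`) whose integrands agree there with `g(x) = (x 1 − x 0)/√(|P(x 0)|·|P(x 1)|)`,
the combination `[r₁₂] − [r₁₄] + [r₃₄]` lies in `KZ.relations` (value: Riemann's bilinear relation
`W₁₂ − W₁₄ + W₃₄ = 0` for the first-kind forms `dx/y, x dx/y` of `y² = P(x)`).

This file records what every proof must respect, all at the level of the only known invariant of
`KZ.relations`, the value (`KZ.relations_le_ker_eval_holds`):

* §1–§2 the integrand is STRICTLY POSITIVE on each of the three boxes (`x 1 − x 0 > 0` there and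
  no coordinate is a root), so every admissible representation has positive value
  (`value_pos_of_box`, `value_pos₁₂`, `value_pos₁₄`, `value_pos₃₄`): the crux says
  `W₁₄ = W₁₂ + W₃₄` with all three terms positive (`value_eq_of_mem_relations`);
* §3 refuted sign patterns / natural strengthenings: no single box, no same-sign pair and not the
  all-plus combination is a relation (`of₁₄_not_mem_relations`, `pair_not_mem_relations`,
  `all_plus_not_mem_relations`) — a proof must cancel AGAINST `J₁ × J₄`;
* §4 forced moves: not derivable by rules (2)+(3) alone (coefficient sum `1`,
  `KZ.closure_cov_nl_le_ker_coeffSum`) nor by the additivity rules alone (restricted evaluation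
  through `{x | ∀ i, e 2 < x i}` is `W₃₄ > 0`, `KZ.closure_add_le_ker_restrictedEval`);
* §5 the `∀ r₁₂ r₁₄ r₃₄` form hides no strength — ONE admissible triple in `relations` per `e`
  suffices (`hyperellipticRiemannRelation_of_exists`) — and the summit together with the real
  identity `W₁₂ − W₁₄ + W₃₄ = 0` implies the crux
  (`hyperellipticRiemannRelation_of_kontsevichZagierPeriods`): an invariant-based refutation of
  the crux would refute `KontsevichZagierPeriods` itself.

No definitions are introduced (the integrand is written out). Part 2 (`Witnesses`,
`LoadBearing`) exhibits admissible representations and the load-bearing hypotheses.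
[Kontsevich–Zagier 2001, §1.2] [folklore]
-/

noncomputable section

open Set MeasureTheory
open Literature.NumberTheory.Transcendental
open Summit.KontsevichZagierPeriods.KontsevichZagierPeriods.Theses.UnfoldedStokes
  (HyperellipticRiemannRelation)

namespace Summit.KontsevichZagierPeriods.UnfoldedStokes.HyperellipticRiemannRelationNegative

/-! ### §0 Values of the combination (soundness `KZ.relations_le_ker_eval_holds`, unfolded) -/

/-- The value of the crux combination. [folklore] -/
theorem eval_combination (r₁₂ r₁₄ r₃₄ : KZ.IntegralRep 2) :
    KZ.eval (KZ.of r₁₂ - KZ.of r₁₄ + KZ.of r₃₄) = r₁₂.value - r₁₄.value + r₃₄.value := by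
  simp only [map_add, map_sub, KZ.eval_of]

/-- If the crux combination is a relation then `W₁₄ = W₁₂ + W₃₄`. [folklore] -/
theorem value_eq_of_mem_relations {r₁₂ r₁₄ r₃₄ : KZ.IntegralRep 2}
    (h : KZ.of r₁₂ - KZ.of r₁₄ + KZ.of r₃₄ ∈ KZ.relations) :
    r₁₄.value = r₁₂.value + r₃₄.value := by
  have := (AddMonoidHom.mem_ker).1 (KZ.relations_le_ker_eval_holds h)
  rw [eval_combination] at this
  linarith

/-! ### §1 The integrand is positive on ordered boxes -/

/-- Between two consecutive roots the quintic does not vanish. [folklore] -/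
theorem prod_ne_zero_of_mem_gap {e : Fin 5 → ℚ} (he : StrictMono e) {t : ℝ} (j : Fin 4)
    (h1 : (e (Fin.castSucc j) : ℝ) < t) (h2 : t < (e (Fin.succ j) : ℝ)) :
    ∏ i : Fin 5, (t - (e i : ℝ)) ≠ 0 := by
  rw [Finset.prod_ne_zero_iff]
  intro i _
  rcases le_or_gt i (Fin.castSucc j) with hi | hi
  · have : (e i : ℝ) ≤ (e (Fin.castSucc j) : ℝ) := by exact_mod_cast he.monotone hi
    exact sub_ne_zero.2 (by linarith)
  · have hi' : Fin.succ j ≤ i := by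
      rw [Fin.lt_def] at hi
      rw [Fin.le_def]
      simp only [Fin.val_castSucc, Fin.val_succ] at hi ⊢
      omega
    have : (e (Fin.succ j) : ℝ) ≤ (e i : ℝ) := by exact_mod_cast he.monotone hi'
    exact sub_ne_zero.2 (by linarith)

/-- The box integrand is strictly positive wherever `x 0 < x 1` and neither coordinate is a root.
[folklore] -/
theorem integrand_pos_of {e : Fin 5 → ℚ} {x : Fin 2 → ℝ} (hlt : x 0 < x 1)
    (h0 : ∏ i : Fin 5, (x 0 - (e i : ℝ)) ≠ 0) (h1 : ∏ i : Fin 5, (x 1 - (e i : ℝ)) ≠ 0) :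
    0 < (x 1 - x 0) / Real.sqrt (|∏ i : Fin 5, (x 0 - (e i : ℝ))| * |∏ i : Fin 5, (x 1 - (e i : ℝ))|) :=
  div_pos (sub_pos.2 hlt) (Real.sqrt_pos.2 (mul_pos (abs_pos.2 h0) (abs_pos.2 h1)))

/-! ### §2 Values of admissible representations are positive -/

/-- An open box `(a,b) × (c,d) ⊆ ℝ²` with `a < b`, `c < d` has positive Lebesgue measure.
[folklore] -/
theorem volume_box_pos {a b c d : ℝ} (hab : a < b) (hcd : c < d) :
    0 < volume {x : Fin 2 → ℝ | a < x 0 ∧ x 0 < b ∧ c < x 1 ∧ x 1 < d} := by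
  have hopen : IsOpen {x : Fin 2 → ℝ | a < x 0 ∧ x 0 < b ∧ c < x 1 ∧ x 1 < d} := by
    refine (isOpen_lt continuous_const (continuous_apply 0)).inter
      ((isOpen_lt (continuous_apply 0) continuous_const).inter
      ((isOpen_lt continuous_const (continuous_apply 1)).inter
      (isOpen_lt (continuous_apply 1) continuous_const)))
  have hne : ({x : Fin 2 → ℝ | a < x 0 ∧ x 0 < b ∧ c < x 1 ∧ x 1 < d}).Nonempty :=
    ⟨![(a + b) / 2, (c + d) / 2], by
      simp only [mem_setOf_eq, Matrix.cons_val_zero, Matrix.cons_val_one]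
      refine ⟨?_, ?_, ?_, ?_⟩ <;> linarith⟩
  exact hopen.measure_pos volume hne

/-- **Positivity of admissible values.** A representation whose domain is a box
`(a,b) × (c,d)` with `b ≤ c` lying in two gaps of the quintic (no root inside either interval)
and whose integrand is the crux integrand on it has STRICTLY POSITIVE value. [folklore] -/
theorem value_pos_of_box {e : Fin 5 → ℚ} (he : StrictMono e) (j k : Fin 4)
    (hjk : (e (Fin.succ j) : ℝ) ≤ (e (Fin.castSucc k) : ℝ))
    (r : KZ.IntegralRep 2)
    (hd : r.domain = {x | (e (Fin.castSucc j) : ℝ) < x 0 ∧ x 0 < (e (Fin.succ j) : ℝ) ∧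
      (e (Fin.castSucc k) : ℝ) < x 1 ∧ x 1 < (e (Fin.succ k) : ℝ)})
    (hi : EqOn r.integrand (fun x => (x 1 - x 0) /
      Real.sqrt (|∏ i : Fin 5, (x 0 - (e i : ℝ))| * |∏ i : Fin 5, (x 1 - (e i : ℝ))|)) r.domain) :
    0 < r.value := by
  have hm : MeasurableSet r.domain := KZ.IntegralRep.measurableSet_domain_holds r
  have hpos : ∀ x ∈ r.domain, 0 < r.integrand x := by
    intro x hx
    rw [hi hx]
    rw [hd] at hx
    obtain ⟨h0a, h0b, h1a, h1b⟩ := hx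
    exact integrand_pos_of (by linarith) (prod_ne_zero_of_mem_gap he j h0a h0b)
      (prod_ne_zero_of_mem_gap he k h1a h1b)
  rw [KZ.IntegralRep.value, setIntegral_pos_iff_support_of_nonneg_ae
    ((ae_restrict_mem hm).mono fun x hx => (hpos x hx).le) r.integrableOn]
  have hsupp : Function.support r.integrand ∩ r.domain = r.domain :=
    inter_eq_right.2 fun x hx => Function.mem_support.2 (hpos x hx).ne'
  rw [hsupp, hd]
  have hj : (e (Fin.castSucc j) : ℝ) < (e (Fin.succ j) : ℝ) := by
    exact_mod_cast he (Fin.castSucc_lt_succ (i := j))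
  have hk : (e (Fin.castSucc k) : ℝ) < (e (Fin.succ k) : ℝ) := by
    exact_mod_cast he (Fin.castSucc_lt_succ (i := k))
  exact volume_box_pos hj hk

/-- `W₁₂ > 0` for every admissible `r₁₂`. [folklore] -/
theorem value_pos₁₂ {e : Fin 5 → ℚ} (he : StrictMono e) (r : KZ.IntegralRep 2)
    (hd : r.domain = {x | (e 0 : ℝ) < x 0 ∧ x 0 < (e 1 : ℝ) ∧ (e 1 : ℝ) < x 1 ∧ x 1 < (e 2 : ℝ)})
    (hi : EqOn r.integrand (fun x => (x 1 - x 0) /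
      Real.sqrt (|∏ i : Fin 5, (x 0 - (e i : ℝ))| * |∏ i : Fin 5, (x 1 - (e i : ℝ))|)) r.domain) :
    0 < r.value :=
  value_pos_of_box he 0 1 le_rfl r hd hi

/-- `W₁₄ > 0` for every admissible `r₁₄`. [folklore] -/
theorem value_pos₁₄ {e : Fin 5 → ℚ} (he : StrictMono e) (r : KZ.IntegralRep 2)
    (hd : r.domain = {x | (e 0 : ℝ) < x 0 ∧ x 0 < (e 1 : ℝ) ∧ (e 3 : ℝ) < x 1 ∧ x 1 < (e 4 : ℝ)})
    (hi : EqOn r.integrand (fun x => (x 1 - x 0) /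
      Real.sqrt (|∏ i : Fin 5, (x 0 - (e i : ℝ))| * |∏ i : Fin 5, (x 1 - (e i : ℝ))|)) r.domain) :
    0 < r.value :=
  value_pos_of_box he 0 3 (by exact_mod_cast he.monotone (by decide)) r hd hi

/-- `W₃₄ > 0` for every admissible `r₃₄`. [folklore] -/
theorem value_pos₃₄ {e : Fin 5 → ℚ} (he : StrictMono e) (r : KZ.IntegralRep 2)
    (hd : r.domain = {x | (e 2 : ℝ) < x 0 ∧ x 0 < (e 3 : ℝ) ∧ (e 3 : ℝ) < x 1 ∧ x 1 < (e 4 : ℝ)})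
    (hi : EqOn r.integrand (fun x => (x 1 - x 0) /
      Real.sqrt (|∏ i : Fin 5, (x 0 - (e i : ℝ))| * |∏ i : Fin 5, (x 1 - (e i : ℝ))|)) r.domain) :
    0 < r.value :=
  value_pos_of_box he 2 3 le_rfl r hd hi

/-! ### §3 Sign patterns: refuted natural strengthenings

Every admissible value is positive, so a formal combination of admissible boxes with all
coefficients of one sign is never a relation. In particular no single box `[J_j × J_k, g]` is a
relation, the ALL-PLUS pattern `[r₁₂] + [r₁₄] + [r₃₄]` is not, and no same-sign pair is. The
patterns `(+,−,−)` and `(+,+,−)` have values `∓2W₃₄`, `2W₁₂` GIVEN the crux, but without it their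
non-vanishing is a quantitative statement about hyperelliptic integrals (not attempted in Lean;
numerically `|value| ≥ 0.25` at `{0,1,2,3,5}`). -/

/-- A representation of non-zero value is not a relation. [cite: KontsevichZagier2001, §1.2] -/
theorem of_not_mem_relations_of_value_pos {n : ℕ} {r : KZ.IntegralRep n} (h : 0 < r.value) :
    KZ.of r ∉ KZ.relations := fun hr => by
  have := (AddMonoidHom.mem_ker).1 (KZ.relations_le_ker_eval_holds hr)
  rw [KZ.eval_of] at this
  exact h.ne' this

/-- Three representations of positive value never sum to a relation. [cite: KontsevichZagier2001, §1.2] -/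
theorem add_add_not_mem_relations_of_value_pos {n : ℕ} {r s t : KZ.IntegralRep n}
    (hr : 0 < r.value) (hs : 0 < s.value) (ht : 0 < t.value) :
    KZ.of r + KZ.of s + KZ.of t ∉ KZ.relations := fun h => by
  have := (AddMonoidHom.mem_ker).1 (KZ.relations_le_ker_eval_holds h)
  simp only [map_add, KZ.eval_of] at this
  linarith

/-- Two representations of positive value never sum to a relation. [cite: KontsevichZagier2001, §1.2] -/
theorem add_not_mem_relations_of_value_pos {n : ℕ} {r s : KZ.IntegralRep n}
    (hr : 0 < r.value) (hs : 0 < s.value) : KZ.of r + KZ.of s ∉ KZ.relations := fun h => by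
  have := (AddMonoidHom.mem_ker).1 (KZ.relations_le_ker_eval_holds h)
  simp only [map_add, KZ.eval_of] at this
  linarith

/-- Two representations of DIFFERENT value never differ by a relation. [cite: KontsevichZagier2001, §1.2] -/
theorem sub_not_mem_relations_of_value_ne {n m : ℕ} {r : KZ.IntegralRep n} {s : KZ.IntegralRep m}
    (h : r.value ≠ s.value) : KZ.of r - KZ.of s ∉ KZ.relations := fun h' => by
  have := (AddMonoidHom.mem_ker).1 (KZ.relations_le_ker_eval_holds h')
  simp only [map_sub, KZ.eval_of, sub_eq_zero] at this
  exact h this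

/-- **The all-plus pattern is not a relation**: for every strictly increasing `e` and every
admissible triple, `[r₁₂] + [r₁₄] + [r₃₄] ∉ KZ.relations` (value `W₁₂ + W₁₄ + W₃₄ > 0`). So any
proof of the crux must produce a cancellation AGAINST the box `J₁ × J₄`.
[cite: KontsevichZagier2001, §1.2] -/
theorem all_plus_not_mem_relations {e : Fin 5 → ℚ} (he : StrictMono e)
    (r₁₂ r₁₄ r₃₄ : KZ.IntegralRep 2)
    (hd₁₂ : r₁₂.domain = {x | (e 0 : ℝ) < x 0 ∧ x 0 < (e 1 : ℝ) ∧ (e 1 : ℝ) < x 1 ∧ x 1 < (e 2 : ℝ)})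
    (hd₁₄ : r₁₄.domain = {x | (e 0 : ℝ) < x 0 ∧ x 0 < (e 1 : ℝ) ∧ (e 3 : ℝ) < x 1 ∧ x 1 < (e 4 : ℝ)})
    (hd₃₄ : r₃₄.domain = {x | (e 2 : ℝ) < x 0 ∧ x 0 < (e 3 : ℝ) ∧ (e 3 : ℝ) < x 1 ∧ x 1 < (e 4 : ℝ)})
    (hi₁₂ : EqOn r₁₂.integrand (fun x => (x 1 - x 0) /
      Real.sqrt (|∏ i : Fin 5, (x 0 - (e i : ℝ))| * |∏ i : Fin 5, (x 1 - (e i : ℝ))|)) r₁₂.domain)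
    (hi₁₄ : EqOn r₁₄.integrand (fun x => (x 1 - x 0) /
      Real.sqrt (|∏ i : Fin 5, (x 0 - (e i : ℝ))| * |∏ i : Fin 5, (x 1 - (e i : ℝ))|)) r₁₄.domain)
    (hi₃₄ : EqOn r₃₄.integrand (fun x => (x 1 - x 0) /
      Real.sqrt (|∏ i : Fin 5, (x 0 - (e i : ℝ))| * |∏ i : Fin 5, (x 1 - (e i : ℝ))|)) r₃₄.domain) :
    KZ.of r₁₂ + KZ.of r₁₄ + KZ.of r₃₄ ∉ KZ.relations :=
  add_add_not_mem_relations_of_value_pos (value_pos₁₂ he r₁₂ hd₁₂ hi₁₂)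
    (value_pos₁₄ he r₁₄ hd₁₄ hi₁₄) (value_pos₃₄ he r₃₄ hd₃₄ hi₃₄)

/-- **No single box is a relation**, e.g. `[r₁₄] ∉ KZ.relations`: the crux is genuinely a
three-term identity at the level of values (`W₁₄ = W₁₂ + W₃₄` with all three positive).
[cite: KontsevichZagier2001, §1.2] -/
theorem of₁₄_not_mem_relations {e : Fin 5 → ℚ} (he : StrictMono e) (r₁₄ : KZ.IntegralRep 2)
    (hd₁₄ : r₁₄.domain = {x | (e 0 : ℝ) < x 0 ∧ x 0 < (e 1 : ℝ) ∧ (e 3 : ℝ) < x 1 ∧ x 1 < (e 4 : ℝ)})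
    (hi₁₄ : EqOn r₁₄.integrand (fun x => (x 1 - x 0) /
      Real.sqrt (|∏ i : Fin 5, (x 0 - (e i : ℝ))| * |∏ i : Fin 5, (x 1 - (e i : ℝ))|)) r₁₄.domain) :
    KZ.of r₁₄ ∉ KZ.relations :=
  of_not_mem_relations_of_value_pos (value_pos₁₄ he r₁₄ hd₁₄ hi₁₄)

/-- **No same-sign pair is a relation**, e.g. `[r₁₂] + [r₃₄] ∉ KZ.relations` (dropping the middle
term of the crux and flipping nothing leaves value `W₁₂ + W₃₄ = W₁₄ > 0`).
[cite: KontsevichZagier2001, §1.2] -/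
theorem pair_not_mem_relations {e : Fin 5 → ℚ} (he : StrictMono e) (r₁₂ r₃₄ : KZ.IntegralRep 2)
    (hd₁₂ : r₁₂.domain = {x | (e 0 : ℝ) < x 0 ∧ x 0 < (e 1 : ℝ) ∧ (e 1 : ℝ) < x 1 ∧ x 1 < (e 2 : ℝ)})
    (hd₃₄ : r₃₄.domain = {x | (e 2 : ℝ) < x 0 ∧ x 0 < (e 3 : ℝ) ∧ (e 3 : ℝ) < x 1 ∧ x 1 < (e 4 : ℝ)})
    (hi₁₂ : EqOn r₁₂.integrand (fun x => (x 1 - x 0) /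
      Real.sqrt (|∏ i : Fin 5, (x 0 - (e i : ℝ))| * |∏ i : Fin 5, (x 1 - (e i : ℝ))|)) r₁₂.domain)
    (hi₃₄ : EqOn r₃₄.integrand (fun x => (x 1 - x 0) /
      Real.sqrt (|∏ i : Fin 5, (x 0 - (e i : ℝ))| * |∏ i : Fin 5, (x 1 - (e i : ℝ))|)) r₃₄.domain) :
    KZ.of r₁₂ + KZ.of r₃₄ ∉ KZ.relations :=
  add_not_mem_relations_of_value_pos (value_pos₁₂ he r₁₂ hd₁₂ hi₁₂) (value_pos₃₄ he r₃₄ hd₃₄ hi₃₄)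

/-! ### §4 Forced moves: the relation lies in no obvious sub-calculus -/

/-- **Not derivable by change of variables + Newton–Leibniz alone** (rules (2)+(3)): the
coefficient sum of `[r₁₂] − [r₁₄] + [r₃₄]` is `1` (`KZ.closure_cov_nl_le_ker_coeffSum`), so at
least one additivity move is needed. Holds for ARBITRARY representations.
[cite: KontsevichZagier2001, §1.2] -/
theorem not_mem_closure_cov_nl {n : ℕ} (r₁₂ r₁₄ r₃₄ : KZ.IntegralRep n) :
    KZ.of r₁₂ - KZ.of r₁₄ + KZ.of r₃₄ ∉
      AddSubgroup.closure (KZ.changeOfVariablesRel ∪ KZ.newtonLeibnizRel) := by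
  intro h
  have := KZ.closure_cov_nl_le_ker_coeffSum h
  rw [AddMonoidHom.mem_ker] at this
  simp at this

/-- **Not derivable by the two additivity rules alone** (rules (1a)+(1b)): restricted evaluation
through the windows `{x | ∀ i, e 2 < x i}` (an invariant of the additivity moves,
`KZ.closure_add_le_ker_restrictedEval`) kills `r₁₂`, `r₁₄` (first coordinate `< e 1 < e 2`) and
sees all of `r₃₄`, giving `W₃₄ > 0`. So at least one move of type (2) or (3) is needed.
[cite: KontsevichZagier2001, §1.2] -/
theorem not_mem_closure_add {e : Fin 5 → ℚ} (he : StrictMono e) (r₁₂ r₁₄ r₃₄ : KZ.IntegralRep 2)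
    (hd₁₂ : r₁₂.domain = {x | (e 0 : ℝ) < x 0 ∧ x 0 < (e 1 : ℝ) ∧ (e 1 : ℝ) < x 1 ∧ x 1 < (e 2 : ℝ)})
    (hd₁₄ : r₁₄.domain = {x | (e 0 : ℝ) < x 0 ∧ x 0 < (e 1 : ℝ) ∧ (e 3 : ℝ) < x 1 ∧ x 1 < (e 4 : ℝ)})
    (hd₃₄ : r₃₄.domain = {x | (e 2 : ℝ) < x 0 ∧ x 0 < (e 3 : ℝ) ∧ (e 3 : ℝ) < x 1 ∧ x 1 < (e 4 : ℝ)})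
    (hi₃₄ : EqOn r₃₄.integrand (fun x => (x 1 - x 0) /
      Real.sqrt (|∏ i : Fin 5, (x 0 - (e i : ℝ))| * |∏ i : Fin 5, (x 1 - (e i : ℝ))|)) r₃₄.domain) :
    KZ.of r₁₂ - KZ.of r₁₄ + KZ.of r₃₄ ∉ AddSubgroup.closure (KZ.domainAddRel ∪ KZ.integrandAddRel) := by
  intro h
  set A : (n : ℕ) → Set (Fin n → ℝ) := fun n => {x | ∀ i, (e 2 : ℝ) < x i} with hA
  have hAm : ∀ n, MeasurableSet (A n) := fun n => by
    have : A n = ⋂ i, {x : Fin n → ℝ | (e 2 : ℝ) < x i} := by ext x; simp [hA]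
    rw [this]
    exact MeasurableSet.iInter fun i => measurableSet_lt measurable_const (measurable_pi_apply i)
  have h12 : (e 1 : ℝ) < (e 2 : ℝ) := by exact_mod_cast he (by decide)
  have hk := KZ.closure_add_le_ker_restrictedEval A hAm h
  rw [AddMonoidHom.mem_ker, map_add, map_sub, KZ.restrictedEval_of, KZ.restrictedEval_of,
    KZ.restrictedEval_of] at hk
  have e₁ : r₁₂.domain ∩ A 2 = ∅ := by
    rw [hd₁₂]; ext x
    simp only [hA, mem_inter_iff, mem_setOf_eq, mem_empty_iff_false, iff_false, not_and]
    intro hx hall; linarith [hall 0, hx.2.1]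
  have e₂ : r₁₄.domain ∩ A 2 = ∅ := by
    rw [hd₁₄]; ext x
    simp only [hA, mem_inter_iff, mem_setOf_eq, mem_empty_iff_false, iff_false, not_and]
    intro hx hall; linarith [hall 0, hx.2.1]
  have e₃ : r₃₄.domain ∩ A 2 = r₃₄.domain := by
    rw [hd₃₄]
    refine inter_eq_left.2 fun x hx => ?_
    have h23 : (e 2 : ℝ) < (e 3 : ℝ) := by exact_mod_cast he (by decide)
    intro i; fin_cases i
    · exact hx.1
    · exact h23.trans hx.2.2.1
  rw [e₁, e₂, e₃] at hk
  simp only [Measure.restrict_empty, integral_zero_measure, sub_zero, zero_add] at hk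
  exact (value_pos₃₄ he r₃₄ hd₃₄ hi₃₄).ne' hk

/-! ### §5 The `∀`-form is one instance; the crux is the summit restricted to one identity -/

/-- **One admissible triple per configuration suffices.** If for every strictly increasing `e`
SOME admissible triple gives a relation, the crux holds: admissible representations with the
same domain are congruent modulo `KZ.relations` (`KZ.of_sub_of_mem_relations_of_eqOn`), so the
universal quantifier over `r₁₂ r₁₄ r₃₄` hides no extra strength. (The converse needs existence of
admissible triples, `Negative/Witnesses`.) [cite: KontsevichZagier2001, §1.2 rule (1)] -/
theorem hyperellipticRiemannRelation_of_exists
    (H : ∀ e : Fin 5 → ℚ, StrictMono e → ∃ s₁₂ s₁₄ s₃₄ : KZ.IntegralRep 2,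
      s₁₂.domain = {x | (e 0 : ℝ) < x 0 ∧ x 0 < (e 1 : ℝ) ∧ (e 1 : ℝ) < x 1 ∧ x 1 < (e 2 : ℝ)} ∧
      s₁₄.domain = {x | (e 0 : ℝ) < x 0 ∧ x 0 < (e 1 : ℝ) ∧ (e 3 : ℝ) < x 1 ∧ x 1 < (e 4 : ℝ)} ∧
      s₃₄.domain = {x | (e 2 : ℝ) < x 0 ∧ x 0 < (e 3 : ℝ) ∧ (e 3 : ℝ) < x 1 ∧ x 1 < (e 4 : ℝ)} ∧
      EqOn s₁₂.integrand (fun x => (x 1 - x 0) /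
        Real.sqrt (|∏ i : Fin 5, (x 0 - (e i : ℝ))| * |∏ i : Fin 5, (x 1 - (e i : ℝ))|)) s₁₂.domain ∧
      EqOn s₁₄.integrand (fun x => (x 1 - x 0) /
        Real.sqrt (|∏ i : Fin 5, (x 0 - (e i : ℝ))| * |∏ i : Fin 5, (x 1 - (e i : ℝ))|)) s₁₄.domain ∧
      EqOn s₃₄.integrand (fun x => (x 1 - x 0) /
        Real.sqrt (|∏ i : Fin 5, (x 0 - (e i : ℝ))| * |∏ i : Fin 5, (x 1 - (e i : ℝ))|)) s₃₄.domain ∧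
      KZ.of s₁₂ - KZ.of s₁₄ + KZ.of s₃₄ ∈ KZ.relations) :
    HyperellipticRiemannRelation := by
  intro e he r₁₂ r₁₄ r₃₄ hd₁₂ hd₁₄ hd₃₄ hi₁₂ hi₁₄ hi₃₄
  obtain ⟨s₁₂, s₁₄, s₃₄, hs₁₂, hs₁₄, hs₃₄, hj₁₂, hj₁₄, hj₃₄, h⟩ := H e he
  have c₁₂ : KZ.of r₁₂ - KZ.of s₁₂ ∈ KZ.relations :=
    KZ.of_sub_of_mem_relations_of_eqOn (by rw [hd₁₂, hs₁₂])
      (fun p hp => (hi₁₂ hp).trans (hj₁₂ (by rw [hs₁₂]; rw [hd₁₂] at hp; exact hp)).symm)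
  have c₁₄ : KZ.of r₁₄ - KZ.of s₁₄ ∈ KZ.relations :=
    KZ.of_sub_of_mem_relations_of_eqOn (by rw [hd₁₄, hs₁₄])
      (fun p hp => (hi₁₄ hp).trans (hj₁₄ (by rw [hs₁₄]; rw [hd₁₄] at hp; exact hp)).symm)
  have c₃₄ : KZ.of r₃₄ - KZ.of s₃₄ ∈ KZ.relations :=
    KZ.of_sub_of_mem_relations_of_eqOn (by rw [hd₃₄, hs₃₄])
      (fun p hp => (hi₃₄ hp).trans (hj₃₄ (by rw [hs₃₄]; rw [hd₃₄] at hp; exact hp)).symm)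
  have := KZ.relations.add_mem (KZ.relations.sub_mem (KZ.relations.add_mem h c₁₂) c₁₄) c₃₄
  convert this using 1
  abel

/-- **A refutation of the crux would refute the summit** (modulo the certified value identity).
If `W₁₂ − W₁₄ + W₃₄ = 0` for admissible triples — Riemann's bilinear relation for `dx/y`, `x dx/y`
on `y² = P(x)` (boundary phases `(−i,1,i,−1,−i,1)`; certified numerically to `1e−15` relative on
27 configurations, `num/genus2_float.py`) — then the summit `KontsevichZagierPeriods`
(equivalently its kernel form, `kzKernelConjecture_iff_isRational`) implies the crux. Hence an
additive invariant of `KZ.FormalRep` vanishing on the four move sets but not on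
`[r₁₂] − [r₁₄] + [r₃₄]` would disprove the summit itself. [cite: KontsevichZagier2001, §1.2 Conjecture 1] -/
theorem hyperellipticRiemannRelation_of_kontsevichZagierPeriods
    (hval : ∀ e : Fin 5 → ℚ, StrictMono e → ∀ r₁₂ r₁₄ r₃₄ : KZ.IntegralRep 2,
      r₁₂.domain = {x | (e 0 : ℝ) < x 0 ∧ x 0 < (e 1 : ℝ) ∧ (e 1 : ℝ) < x 1 ∧ x 1 < (e 2 : ℝ)} →
      r₁₄.domain = {x | (e 0 : ℝ) < x 0 ∧ x 0 < (e 1 : ℝ) ∧ (e 3 : ℝ) < x 1 ∧ x 1 < (e 4 : ℝ)} →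
      r₃₄.domain = {x | (e 2 : ℝ) < x 0 ∧ x 0 < (e 3 : ℝ) ∧ (e 3 : ℝ) < x 1 ∧ x 1 < (e 4 : ℝ)} →
      EqOn r₁₂.integrand (fun x => (x 1 - x 0) /
        Real.sqrt (|∏ i : Fin 5, (x 0 - (e i : ℝ))| * |∏ i : Fin 5, (x 1 - (e i : ℝ))|)) r₁₂.domain →
      EqOn r₁₄.integrand (fun x => (x 1 - x 0) /
        Real.sqrt (|∏ i : Fin 5, (x 0 - (e i : ℝ))| * |∏ i : Fin 5, (x 1 - (e i : ℝ))|)) r₁₄.domain →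
      EqOn r₃₄.integrand (fun x => (x 1 - x 0) /
        Real.sqrt (|∏ i : Fin 5, (x 0 - (e i : ℝ))| * |∏ i : Fin 5, (x 1 - (e i : ℝ))|)) r₃₄.domain →
      r₁₂.value - r₁₄.value + r₃₄.value = 0)
    (hKZ : KontsevichZagierPeriods) : HyperellipticRiemannRelation := by
  have hK : KZKernelConjecture := kzKernelConjecture_iff_isRational.mpr hKZ
  intro e he r₁₂ r₁₄ r₃₄ hd₁₂ hd₁₄ hd₃₄ hi₁₂ hi₁₄ hi₃₄
  apply hK
  rw [eval_combination]
  exact hval e he r₁₂ r₁₄ r₃₄ hd₁₂ hd₁₄ hd₃₄ hi₁₂ hi₁₄ hi₃₄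

end Summit.KontsevichZagierPeriods.UnfoldedStokes.HyperellipticRiemannRelationNegative

end
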